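import Mathlib
import Summits.Ventures.PercRepro2.Tail2DBlockCalc
import Summits.Ventures.PercRepro2.Tail2DHarrisSP
import Summits.Ventures.PercRepro2.Tail2DFlowOneBlocks
import Summits.Ventures.PercRepro2.Tail2DFlowOneStep01
import Summits.Ventures.PercRepro2.Tail2DParFin

/-!
# Words of `k` flow-one factors: flipping reds and unflipping blues
(seat mine-b, cell pub-perc-repro2; conjectures/MINE-B.md §43)

The combinatorics of the diagonal certificate of `Tail2DParFinDiag.lean`: turning a set `J` of red positions of a
word blue (`flipSet`) and back (`unflip`), the letter counts of the results, and the recovery of the word and the set.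
-/

namespace Summit.Ventures.PercRepro2.Tail2D

open V2Closure Finset

section Flip

variable (k : ℕ)

/-- the red positions of a word -/
def redSet (w : Fin k → Ltr) : Finset (Fin k) := Finset.univ.filter (fun i => w i = Ltr.R)

/-- turn the letters on `J` blue -/
def flipSet (w : Fin k → Ltr) (J : Finset (Fin k)) : Fin k → Ltr := fun i => if i ∈ J then Ltr.B else w i

/-- `#R(w) = #redSet w` -/
theorem nR_eq_card_redSet (w : Fin k → Ltr) : nR k w = (redSet k w).card := rfl

/-- flipping a set of reds: the number of `B`s grows by the size of the set -/
theorem nB_flipSet (w : Fin k → Ltr) (J : Finset (Fin k)) (hJ : J ⊆ redSet k w) :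
    nB k (flipSet k w J) = nB k w + J.card := by
  unfold nB flipSet
  have e : (Finset.univ.filter (fun i => (if i ∈ J then Ltr.B else w i) = Ltr.B))
      = J ∪ Finset.univ.filter (fun i => w i = Ltr.B) := by
    ext i
    simp only [Finset.mem_filter, Finset.mem_univ, true_and, Finset.mem_union]
    by_cases hi : i ∈ J
    · simp [hi]
    · simp [hi]
  rw [e, Finset.card_union_of_disjoint, add_comm]
  rw [Finset.disjoint_left]
  intro i hi hi'
  have := hJ hi
  simp only [redSet, Finset.mem_filter, Finset.mem_univ, true_and] at this hi'
  rw [this] at hi'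
  exact Ltr.noConfusion hi'

/-- flipping a set of reds: the number of `R`s drops by the size of the set -/
theorem nR_flipSet (w : Fin k → Ltr) (J : Finset (Fin k)) (hJ : J ⊆ redSet k w) :
    nR k (flipSet k w J) + J.card = nR k w := by
  unfold nR flipSet
  have e : Finset.univ.filter (fun i => w i = Ltr.R)
      = (Finset.univ.filter (fun i => (if i ∈ J then Ltr.B else w i) = Ltr.R)) ∪ J := by
    ext i
    simp only [Finset.mem_filter, Finset.mem_univ, true_and, Finset.mem_union]
    by_cases hi : i ∈ J
    · have := hJ hi
      simp only [redSet, Finset.mem_filter, Finset.mem_univ, true_and] at this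
      simp [hi, this]
    · simp [hi]
  rw [e, Finset.card_union_of_disjoint]
  rw [Finset.disjoint_left]
  intro i hi hi'
  simp only [Finset.mem_filter, Finset.mem_univ, true_and, if_pos hi'] at hi
  exact Ltr.noConfusion hi

/-- flipping reds is a letterwise `R ≼ B` move -/
theorem flipSet_dom_cond (w : Fin k → Ltr) (J : Finset (Fin k)) (hJ : J ⊆ redSet k w) (i : Fin k) :
    w i = flipSet k w J i ∨ (w i = Ltr.R ∧ flipSet k w J i = Ltr.B) := by
  unfold flipSet
  by_cases hi : i ∈ J
  · right
    have := hJ hi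
    simp only [redSet, Finset.mem_filter, Finset.mem_univ, true_and] at this
    exact ⟨this, by simp [hi]⟩
  · left; simp [hi]

/-- the reds of a word, turned blue on `J ⊆ redSet w`, determine `J`: `J = {i : w i = R ∧ flipSet w J i = B}` -/
theorem flipSet_recover (w : Fin k → Ltr) (J : Finset (Fin k)) (hJ : J ⊆ redSet k w) :
    Finset.univ.filter (fun i => w i = Ltr.R ∧ flipSet k w J i = Ltr.B) = J := by
  ext i
  simp only [Finset.mem_filter, Finset.mem_univ, true_and, flipSet]
  by_cases hi : i ∈ J
  · have := hJ hi
    simp only [redSet, Finset.mem_filter, Finset.mem_univ, true_and] at this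
    simp [hi, this]
  · simp only [hi, if_false, iff_false, not_and]
    intro h h'
    rw [h] at h'
    exact Ltr.noConfusion h'

/-- a word is recovered from its flip and the flipped set -/
theorem flipSet_unflip (w : Fin k → Ltr) (J : Finset (Fin k)) (hJ : J ⊆ redSet k w) :
    (fun i => if i ∈ J then Ltr.R else flipSet k w J i) = w := by
  ext i
  unfold flipSet
  by_cases hi : i ∈ J
  · have := hJ hi
    simp only [redSet, Finset.mem_filter, Finset.mem_univ, true_and] at this
    simp [hi, this]
  · simp [hi]

/-- the blue positions of a word -/
def blueSet (w : Fin k → Ltr) : Finset (Fin k) := Finset.univ.filter (fun i => w i = Ltr.B)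

/-- turn the letters on `J` red -/
def unflip (w : Fin k → Ltr) (J : Finset (Fin k)) : Fin k → Ltr := fun i => if i ∈ J then Ltr.R else w i

/-- `#B(w) = #blueSet w` -/
theorem nB_eq_card_blueSet (w : Fin k → Ltr) : nB k w = (blueSet k w).card := rfl

/-- the unflipped set is red in the unflipped word -/
theorem unflip_sub_redSet (w : Fin k → Ltr) (J : Finset (Fin k)) : J ⊆ redSet k (unflip k w J) := by
  intro i hi
  simp only [redSet, unflip, Finset.mem_filter, Finset.mem_univ, true_and, if_pos hi]

/-- flipping back the unflipped set recovers the word, when the set was blue -/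
theorem flipSet_unflip_eq (w : Fin k → Ltr) (J : Finset (Fin k)) (hJ : J ⊆ blueSet k w) :
    flipSet k (unflip k w J) J = w := by
  ext i
  simp only [flipSet, unflip]
  by_cases hi : i ∈ J
  · have := hJ hi
    simp only [blueSet, Finset.mem_filter, Finset.mem_univ, true_and] at this
    simp [hi, this]
  · simp [hi]

/-- the reds of the unflipped word -/
theorem nR_unflip (w : Fin k → Ltr) (J : Finset (Fin k)) (hJ : J ⊆ blueSet k w) :
    nR k (unflip k w J) = nR k w + J.card := by
  have h := nR_flipSet k (unflip k w J) J (unflip_sub_redSet k w J)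
  rw [flipSet_unflip_eq k w J hJ] at h
  exact h.symm

/-- the blues of the unflipped word -/
theorem nB_unflip (w : Fin k → Ltr) (J : Finset (Fin k)) (hJ : J ⊆ blueSet k w) :
    nB k (unflip k w J) + J.card = nB k w := by
  have h := nB_flipSet k (unflip k w J) J (unflip_sub_redSet k w J)
  rw [flipSet_unflip_eq k w J hJ] at h
  exact h.symm

/-- a word whose flip on `J ⊆ redSet` is `w₁` is the unflip of `w₁` on `J` -/
theorem eq_unflip_of_flipSet (w w₁ : Fin k → Ltr) (J : Finset (Fin k)) (hJ : J ⊆ redSet k w)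
    (h : flipSet k w J = w₁) : w = unflip k w₁ J := by
  have := flipSet_unflip k w J hJ
  rw [h] at this
  exact this.symm

/-- a flip on `J ⊆ redSet w` equal to `w₁` forces `J ⊆ blueSet w₁` -/
theorem sub_blueSet_of_flipSet (w w₁ : Fin k → Ltr) (J : Finset (Fin k))
    (h : flipSet k w J = w₁) : J ⊆ blueSet k w₁ := by
  intro i hi
  have := congrFun h i
  simp only [flipSet, if_pos hi] at this
  simp only [blueSet, Finset.mem_filter, Finset.mem_univ, true_and]
  exact this.symm

end Flip


end Summit.Ventures.PercRepro2.Tail2D
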